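import Summits.BirchSwinnertonDyer.BirchSwinnertonDyer.Theorems.ThetaPartnerAtTwoSignedKatoUpToAtTwoFrameChange
import Literature.NumberTheory.EllipticCurves.CyclotomicZpExtensionLayerTwoProofs
import HarnessLib

/-!
# K3 `SignedKatoDivisibilityUpToAtTwo`, line `colemanrat` — FRAME-C: the (KZ) value of the Kato pairing fact does not depend on the
# Galois LIFT FAMILY `τ` (soundness of the fact's `∀ τ` quantifier), in the kernel

Cell `pub/bsd-wall`, width seat `bsd-wall-tp2-p2x-w3` g11, `--supports stmt-BirchSwinnertonDyer-20308` (helper; closes nothing).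
The named fact `F := Kato2004.exists_eulerSystem_expStar_tatePairing_values_two` (p640688) displays the layer Tate pairing value
`t = ⟨Cor z_{2^{n+2}}, Q₀⟩_n ∈ ℤ₂` as `t = Σ_{b ∈ (ℤ/2^{n+2})ˣ} τ_{n+2}(b) • (log_W(z(Q₀)) · e_{n+2}(x))` for EVERY family of Galois lifts
`τ_k(a) ∈ G_{ℚ₂}` of `e_k(ζ) ↦ e_k(ζ)^a`. Since `t` is PINNED by its residues, `F` is consistent only if the right-hand side does not
depend on the choice of `τ` — Step C of the lead's audit `Cruxes/SignedKatoDivisibilityUpToAtTwo/G9-LEAD-AUDIT.md` §4, argued there on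
paper («`L ∈ ℚ₂(e ζ)`»). This file proves it IN THE KERNEL, directly on the tree objects:

* `exists_localGal_over_frame` — every `σ ∈ G_{ℚ₂}` has a transport `σ_v ∈ Γ_v = Gal(\overline{ℚ_v}/ℚ_v)` along a continuous frame
  `Φ` (`σ_v • Φ x = Φ (σ • x)`);
* `resGalOfEmb_mem_rootsOfUnityFixer_of_smul_eq` — an element of `Γ_v` fixing one primitive `N`-th root of unity of `\overline{ℚ_v}`
  restricts (along any `ι : ℚ̄ → \overline{ℚ_v}`) into `Gal(ℚ̄/ℚ(μ_N)) = rootsOfUnityFixer ℚ N`;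
* `map_gal_eq_self_of_smul_zeta_eq` — KEY: if `σ ∈ G_{ℚ₂}` fixes `e(ζ_{2^{n+2}})` and the `Φ`-image of `Q₀ ∈ E(ℚ̄₂)` lies in the layer
  points `E(ℚ_{n,v})` (`localLayerPointsOfEmb`, fixed points of `Gal(\overline{ℚ_v}/ℚ_{n,v})`), then `σ_* Q₀ = Q₀` — via
  `ZpExtension.IsCyclotomic.rootsOfUnityFixer_le_layerSubgroup_two` (`Gal(ℚ̄/ℚ(μ_{2^{n+2}})) ≤ Gal(ℚ̄/ℚ_n)`) and injectivity of `Φ_*`;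
* `gal_smul_kz_summand_eq` — hence `σ` fixes the summand `log_W(z(Q₀)) · e(x)` (Galois passes the formal-log `tsum`, FRAME-A bricks;
  `e` is determined by `e(ζ)`, power basis);
* `kz_rhs_lift_independent` — two lift families give the SAME right-hand side (termwise: `τ'_b = τ_b · (τ_b⁻¹ τ'_b)` with
  `τ_b⁻¹ τ'_b` fixing `e(ζ)`);
* `expStarTatePairing_kz_allLifts_of_oneLift` — the (KZ) clause of `F` for ONE lift family implies it for EVERY lift family, same `t`.

Theorems only (no `def`, no fact, no instance); standard axioms. With FRAME-A (`…FrameChange.lean`, p648170) this certifies the two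
«free» frame quantifiers `∀ Φ φ` and `∀ τ` of `F` harmless; the COHERENT TOWER quantifier `∀ e` (Step B: conjugating the Euler system by
one global lift of `u ∈ ℤ₂ˣ`) is NOT treated here. HONEST FRAMING: `F` stays a named, unproved, print fact; nothing here settles K3/K3P′;
BSD is not proved by any of this.
-/

noncomputable section

open scoped Classical NumberField TensorProduct
open Field IsDedekindDomain CongruenceSubgroup NumberField WeierstrassCurve
open Literature.NumberTheory.GaloisRepresentations
open Literature.NumberTheory.EllipticCurves Literature.NumberTheory.EllipticCurves.ModularForms
open Literature.NumberTheory.EllipticCurves.Rank1Residual Literature.NumberTheory.EllipticCurves.Kobayashi2003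
open Literature.NumberTheory.EllipticCurves.Kato2004 Literature.NumberTheory.EllipticCurves.Kato2004.EulerSystemValues
open ZpExtension

set_option linter.dupNamespace false

namespace Summit.BirchSwinnertonDyer.BirchSwinnertonDyer.Theorems.SignedKatoOffTwo.FrameChange

/-! ## §1 Transport of `G_{ℚ₂}` into `Γ_v` along a continuous frame; roots of unity -/

/-- **Transport along a continuous frame.** For a continuous frame `Φ : ℚ̄_p ≃ₐ[ℚ] \overline{K}` over `φ : ℚ_p ≃+* K` and
`σ ∈ G_{ℚ_p}`, the conjugate `Φ σ Φ⁻¹` fixes `K`, i.e. it is an element `σ_v ∈ Γ_K = Gal(\overline{K}/K)` with `σ_v • Φ x = Φ (σ • x)`.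
[folklore] -/
theorem exists_localGal_over_frame {p : ℕ} [Fact p.Prime] {K : Type*} [Field K] [Algebra ℚ K]
    (Φ : AlgebraicClosure ℚ_[p] ≃ₐ[ℚ] AlgebraicClosure K) (φ : ℚ_[p] ≃+* K)
    (hΦ : ∀ y : ℚ_[p], Φ (algebraMap ℚ_[p] (AlgebraicClosure ℚ_[p]) y) = algebraMap K (AlgebraicClosure K) (φ y))
    (σ : Field.absoluteGaloisGroup ℚ_[p]) :
    ∃ σv : Field.absoluteGaloisGroup K, ∀ x : AlgebraicClosure ℚ_[p], σv • Φ x = Φ (σ • x) := by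
  have hsymm : ∀ y : K, Φ.symm (algebraMap K (AlgebraicClosure K) y) = algebraMap ℚ_[p] (AlgebraicClosure ℚ_[p]) (φ.symm y) := by
    intro y
    rw [AlgEquiv.symm_apply_eq, hΦ, RingEquiv.apply_symm_apply]
  have hcomm : ∀ y : K, (Φ.symm.toRingEquiv.trans
        ((Field.absoluteGaloisGroup.toAlgEquiv ℚ_[p] σ).toRingEquiv.trans Φ.toRingEquiv)) (algebraMap K (AlgebraicClosure K) y) =
      algebraMap K (AlgebraicClosure K) y := by
    intro y
    change Φ (Field.absoluteGaloisGroup.toAlgEquiv ℚ_[p] σ (Φ.symm (algebraMap K (AlgebraicClosure K) y))) = _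
    rw [hsymm, AlgEquiv.commutes, ← hsymm, AlgEquiv.apply_symm_apply]
  refine ⟨(Field.absoluteGaloisGroup.toAlgEquiv K).symm (AlgEquiv.ofRingEquiv
    (f := Φ.symm.toRingEquiv.trans ((Field.absoluteGaloisGroup.toAlgEquiv ℚ_[p] σ).toRingEquiv.trans Φ.toRingEquiv)) hcomm),
    fun x => ?_⟩
  rw [Field.absoluteGaloisGroup.toAlgEquiv_symm_apply, AlgEquiv.ofRingEquiv_apply]
  change Φ (Field.absoluteGaloisGroup.toAlgEquiv ℚ_[p] σ (Φ.symm (Φ x))) = _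
  rw [AlgEquiv.symm_apply_apply]
  rfl

/-- **Fixing one primitive root of unity downstairs fixes all roots of unity upstairs.** If `σ_v ∈ Γ_K` fixes a primitive `N`-th root
of unity `ζ_v ∈ \overline{K}` (`N ≠ 0`), then for every `ℚ`-embedding `ι : ℚ̄ → \overline{K}` the restriction `resGalOfEmb ι σ_v ∈ Γ_ℚ`
fixes every `N`-th root of unity of `ℚ̄` (`ι t` is a power of `ζ_v`). [folklore] -/
theorem resGalOfEmb_mem_rootsOfUnityFixer_of_smul_eq {K : Type} [Field K] [Algebra ℚ K] {N : ℕ} [NeZero N]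
    (ι : AlgebraicClosure ℚ →ₐ[ℚ] AlgebraicClosure K) (σv : Field.absoluteGaloisGroup K) {ζv : AlgebraicClosure K}
    (hζv : IsPrimitiveRoot ζv N) (hfix : σv • ζv = ζv) :
    resGalOfEmb ι σv ∈ rootsOfUnityFixer ℚ N := by
  rw [mem_rootsOfUnityFixer_iff]
  intro t ht
  have hjt : (ι t) ^ N = 1 := by rw [← map_pow, ht, map_one]
  obtain ⟨i, -, hi⟩ := hζv.eq_pow_of_pow_eq_one hjt
  apply ι.toRingHom.injective
  calc ι.toRingHom (resGalOfEmb ι σv • t)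
      = ι ((show AlgebraicClosure ℚ ≃ₐ[ℚ] AlgebraicClosure ℚ from resGalAuxOfEmb ι σv) t) := rfl
    _ = (show AlgebraicClosure K ≃ₐ[K] AlgebraicClosure K from σv) (ι t) := apply_resGalAuxOfEmb_apply ι σv t
    _ = σv • ι t := rfl
    _ = ι.toRingHom t := by rw [← hi, smul_pow', hfix]; exact hi

set_option backward.isDefEq.respectTransparency false in
/-- **Embeddings of `ℚ(ζ_m)` are determined by `ζ_m` (power basis)**: if `σ ∈ G_{ℚ_p}` fixes `e(ζ_m)` then `σ` fixes `e(y)` for every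
`y ∈ ℚ(ζ_m)`. [folklore] -/
theorem gal_smul_cyclotomicEmb_eq {p : ℕ} [Fact p.Prime] {m : ℕ} [NeZero m] (e : CyclotomicField m ℚ →ₐ[ℚ] PadicAlgCl p)
    (σ : Field.absoluteGaloisGroup ℚ_[p])
    (hσ : σ • e (IsCyclotomicExtension.zeta m ℚ (CyclotomicField m ℚ)) = e (IsCyclotomicExtension.zeta m ℚ (CyclotomicField m ℚ)))
    (y : CyclotomicField m ℚ) : σ • e y = e y := by
  have hζ := IsCyclotomicExtension.zeta_spec m ℚ (CyclotomicField m ℚ)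
  have hA : (((AlgEquiv.restrictScalars ℚ (Field.absoluteGaloisGroup.toAlgEquiv ℚ_[p] σ) :
        AlgebraicClosure ℚ_[p] ≃ₐ[ℚ] AlgebraicClosure ℚ_[p]) : AlgebraicClosure ℚ_[p] →ₐ[ℚ] AlgebraicClosure ℚ_[p]).comp e) = e := by
    refine (hζ.powerBasis ℚ).algHom_ext ?_
    rw [IsPrimitiveRoot.powerBasis_gen, AlgHom.comp_apply]
    exact hσ
  exact congrArg (fun f : CyclotomicField m ℚ →ₐ[ℚ] PadicAlgCl p => f y) hA

/-! ## §2 A Galois element fixing `e(ζ_{2^{n+2}})` fixes the points with `Φ`-image in the layer `E(ℚ_{n,v})` -/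

section Layer

variable {v : HeightOneSpectrum (𝓞 ℚ)} {W : WeierstrassCurve ℚ} {κ : ZpExtension ℚ 2} (hκ : κ.IsCyclotomic)

set_option backward.isDefEq.respectTransparency false in
include hκ in
/-- **KEY (Step C of `G9-LEAD-AUDIT.md` §4).** Let `(Φ, φ)` be a continuous `2`-adic completion frame, `κ` cyclotomic,
`e : ℚ(ζ_{2^{n+2}}) → ℚ̄₂`, and `Q₀ ∈ E(ℚ̄₂)` with `Φ_* Q₀ ∈ E(ℚ_{n,v})` (`localLayerPointsOfEmb κ closureEmb W n`). Then every `σ ∈ G_{ℚ₂}`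
fixing `e(ζ_{2^{n+2}})` fixes `Q₀`: its transport `σ_v ∈ Γ_v` fixes the primitive root `Φ(e ζ)`, so `resGalOfEmb closureEmb σ_v` lies in
`Gal(ℚ̄/ℚ(μ_{2^{n+2}})) ≤ Gal(ℚ̄/ℚ_n)` (`IsCyclotomic.rootsOfUnityFixer_le_layerSubgroup_two`), i.e. `σ_v ∈ Gal(\overline{ℚ_v}/ℚ_{n,v})` fixes
`Φ_* Q₀`, and `Φ_*` is injective. (`g` = the action of `σ` as a `ℚ`-algebra map.) [folklore] -/
theorem map_gal_eq_self_of_smul_zeta_eq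
    (Φ : AlgebraicClosure ℚ_[2] ≃ₐ[ℚ] AlgebraicClosure (v.adicCompletion ℚ)) (φ : ℚ_[2] ≃+* v.adicCompletion ℚ)
    (hΦφ : ∀ y : ℚ_[2], Φ (algebraMap ℚ_[2] (AlgebraicClosure ℚ_[2]) y) =
      algebraMap (v.adicCompletion ℚ) (AlgebraicClosure (v.adicCompletion ℚ)) (φ y))
    {n : ℕ} (e : CyclotomicField (cycLevel 2 (n + 2) ∅) ℚ →ₐ[ℚ] PadicAlgCl 2)
    (σ : Field.absoluteGaloisGroup ℚ_[2])
    (hσ : σ • e (IsCyclotomicExtension.zeta (cycLevel 2 (n + 2) ∅) ℚ (CyclotomicField (cycLevel 2 (n + 2) ∅) ℚ)) =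
      e (IsCyclotomicExtension.zeta (cycLevel 2 (n + 2) ∅) ℚ (CyclotomicField (cycLevel 2 (n + 2) ∅) ℚ)))
    (g : AlgebraicClosure ℚ_[2] →ₐ[ℚ] AlgebraicClosure ℚ_[2]) (hg : ∀ x, g x = σ • x)
    (Q₀ : (W.baseChange (AlgebraicClosure ℚ_[2])).toAffine.Point)
    (hQv : WeierstrassCurve.Affine.Point.map (W' := W)
        (Φ : AlgebraicClosure ℚ_[2] →ₐ[ℚ] AlgebraicClosure (v.adicCompletion ℚ)) Q₀ ∈
      localLayerPointsOfEmb κ (closureEmb (K := ℚ) (v.adicCompletion ℚ)) W n) :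
    WeierstrassCurve.Affine.Point.map (W' := W) g Q₀ = Q₀ := by
  obtain ⟨σv, hσv⟩ := exists_localGal_over_frame Φ φ hΦφ σ
  -- `σ_v` fixes the primitive `2^{n+2}`-th root of unity `Φ (e ζ)` of `\overline{ℚ_v}`
  have hζ : IsPrimitiveRoot (Φ (e (IsCyclotomicExtension.zeta (cycLevel 2 (n + 2) ∅) ℚ
      (CyclotomicField (cycLevel 2 (n + 2) ∅) ℚ)))) (2 ^ (n + 2)) := by
    rw [show (2 : ℕ) ^ (n + 2) = cycLevel 2 (n + 2) ∅ by simp [cycLevel]]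
    exact ((IsCyclotomicExtension.zeta_spec (cycLevel 2 (n + 2) ∅) ℚ (CyclotomicField (cycLevel 2 (n + 2) ∅) ℚ)).map_of_injective
      e.toRingHom.injective).map_of_injective Φ.toRingEquiv.injective
  have hfix : σv • Φ (e (IsCyclotomicExtension.zeta (cycLevel 2 (n + 2) ∅) ℚ (CyclotomicField (cycLevel 2 (n + 2) ∅) ℚ))) =
      Φ (e (IsCyclotomicExtension.zeta (cycLevel 2 (n + 2) ∅) ℚ (CyclotomicField (cycLevel 2 (n + 2) ∅) ℚ))) := by
    rw [hσv, hσ]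
  -- hence `σ_v ∈ Gal(\overline{ℚ_v}/ℚ_{n,v})`
  have hmem : σv ∈ localLayerSubgroupOfEmb κ (closureEmb (K := ℚ) (v.adicCompletion ℚ)) n := by
    rw [localLayerSubgroupOfEmb, mem_localSubgroupOfEmb_iff]
    exact hκ.rootsOfUnityFixer_le_layerSubgroup_two n
      (resGalOfEmb_mem_rootsOfUnityFixer_of_smul_eq (closureEmb (K := ℚ) (v.adicCompletion ℚ)) σv hζ hfix)
  -- so `σ_v` fixes `Φ_* Q₀`
  have hfixpt := (mem_localLayerPointsOfEmb_iff κ (closureEmb (K := ℚ) (v.adicCompletion ℚ)) W n _).mp hQv σv hmem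
  rw [localPoints.smul_def] at hfixpt
  change WeierstrassCurve.Affine.Point.map (W' := W) _ (WeierstrassCurve.Affine.Point.map (W' := W) _ Q₀) =
    WeierstrassCurve.Affine.Point.map (W' := W) _ Q₀ at hfixpt
  rw [WeierstrassCurve.Affine.Point.map_map] at hfixpt
  -- `σ_v ∘ Φ = Φ ∘ g`
  have hcomp : ((AlgEquiv.restrictScalars ℚ
        (show AlgebraicClosure (v.adicCompletion ℚ) ≃ₐ[v.adicCompletion ℚ] AlgebraicClosure (v.adicCompletion ℚ) from σv) :
          AlgebraicClosure (v.adicCompletion ℚ) ≃ₐ[ℚ] AlgebraicClosure (v.adicCompletion ℚ)) :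
        AlgebraicClosure (v.adicCompletion ℚ) →ₐ[ℚ] AlgebraicClosure (v.adicCompletion ℚ)).comp
        (Φ : AlgebraicClosure ℚ_[2] →ₐ[ℚ] AlgebraicClosure (v.adicCompletion ℚ)) =
      (Φ : AlgebraicClosure ℚ_[2] →ₐ[ℚ] AlgebraicClosure (v.adicCompletion ℚ)).comp g := by
    refine AlgHom.ext fun x => ?_
    rw [AlgHom.comp_apply, AlgHom.comp_apply, hg]
    exact hσv x
  rw [hcomp, ← WeierstrassCurve.Affine.Point.map_map] at hfixpt
  exact WeierstrassCurve.Affine.Point.map_injective (W' := W) _ hfixpt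

set_option backward.isDefEq.respectTransparency false in
include hκ in
/-- **The (KZ) summand is fixed by every `σ ∈ G_{ℚ₂}` fixing `e(ζ_{2^{n+2}})`**: `σ • (log_W(z(Q₀)) · e(x)) = log_W(z(Q₀)) · e(x)`
(`σ` fixes `Q₀` by `map_gal_eq_self_of_smul_zeta_eq`, passes the formal-log `tsum`, fixes `ℚ₂` and `e(ℚ(ζ))`). [folklore] -/
theorem gal_smul_kz_summand_eq
    (Φ : AlgebraicClosure ℚ_[2] ≃ₐ[ℚ] AlgebraicClosure (v.adicCompletion ℚ)) (φ : ℚ_[2] ≃+* v.adicCompletion ℚ)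
    (hΦφ : ∀ y : ℚ_[2], Φ (algebraMap ℚ_[2] (AlgebraicClosure ℚ_[2]) y) =
      algebraMap (v.adicCompletion ℚ) (AlgebraicClosure (v.adicCompletion ℚ)) (φ y))
    {n : ℕ} (e : CyclotomicField (cycLevel 2 (n + 2) ∅) ℚ →ₐ[ℚ] PadicAlgCl 2)
    (σ : Field.absoluteGaloisGroup ℚ_[2])
    (hσ : σ • e (IsCyclotomicExtension.zeta (cycLevel 2 (n + 2) ∅) ℚ (CyclotomicField (cycLevel 2 (n + 2) ∅) ℚ)) =
      e (IsCyclotomicExtension.zeta (cycLevel 2 (n + 2) ∅) ℚ (CyclotomicField (cycLevel 2 (n + 2) ∅) ℚ)))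
    (Q₀ : localPoints W ℚ_[2])
    (hQv : WeierstrassCurve.Affine.Point.map (W' := W)
        (Φ : AlgebraicClosure ℚ_[2] →ₐ[ℚ] AlgebraicClosure (v.adicCompletion ℚ))
        (show (W.baseChange (AlgebraicClosure ℚ_[2])).toAffine.Point from Q₀) ∈
      localLayerPointsOfEmb κ (closureEmb (K := ℚ) (v.adicCompletion ℚ)) W n)
    (xv : CyclotomicField (cycLevel 2 (n + 2) ∅) ℚ) (a : ℕ → ℚ_[2]) :
    σ • ((∑' i : ℕ, algebraMap ℚ_[2] (PadicAlgCl 2) (a i) *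
          (WeierstrassCurve.Affine.Point.zCoord (show (W.baseChange (AlgebraicClosure ℚ_[2])).toAffine.Point from Q₀)) ^ i) *
        e xv) =
      (∑' i : ℕ, algebraMap ℚ_[2] (PadicAlgCl 2) (a i) *
          (WeierstrassCurve.Affine.Point.zCoord (show (W.baseChange (AlgebraicClosure ℚ_[2])).toAffine.Point from Q₀)) ^ i) *
        e xv := by
  let g : AlgebraicClosure ℚ_[2] →ₐ[ℚ] AlgebraicClosure ℚ_[2] :=
    ((AlgEquiv.restrictScalars ℚ (Field.absoluteGaloisGroup.toAlgEquiv ℚ_[2] σ) :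
        AlgebraicClosure ℚ_[2] ≃ₐ[ℚ] AlgebraicClosure ℚ_[2]) : AlgebraicClosure ℚ_[2] →ₐ[ℚ] AlgebraicClosure ℚ_[2])
  have hg : ∀ x, g x = σ • x := fun _ => rfl
  have hpt := map_gal_eq_self_of_smul_zeta_eq hκ Φ φ hΦφ e σ hσ g hg _ hQv
  have hz : σ • WeierstrassCurve.Affine.Point.zCoord (show (W.baseChange (AlgebraicClosure ℚ_[2])).toAffine.Point from Q₀) =
      WeierstrassCurve.Affine.Point.zCoord (show (W.baseChange (AlgebraicClosure ℚ_[2])).toAffine.Point from Q₀) := by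
    rw [← hg, ← zCoord_map g, hpt]
  rw [smul_mul', gal_smul_tsum_coeff_mul_pow, hz, gal_smul_cyclotomicEmb_eq e σ hσ]

set_option backward.isDefEq.respectTransparency false in
include hκ in
/-- **FRAME-C: the (KZ) right-hand side does not depend on the lift family.** For two families `τ, τ'` of Galois lifts of
`e(ζ) ↦ e(ζ)^b` at the level `2^{n+2}` (`b` a unit), `Σ_b τ_b • (log_W(z(Q₀)) · e(x)) = Σ_b τ'_b • (log_W(z(Q₀)) · e(x))` — termwise, since
`τ_b⁻¹ τ'_b` fixes `e(ζ)` (`gal_smul_kz_summand_eq`). [folklore] -/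
theorem kz_rhs_lift_independent
    (Φ : AlgebraicClosure ℚ_[2] ≃ₐ[ℚ] AlgebraicClosure (v.adicCompletion ℚ)) (φ : ℚ_[2] ≃+* v.adicCompletion ℚ)
    (hΦφ : ∀ y : ℚ_[2], Φ (algebraMap ℚ_[2] (AlgebraicClosure ℚ_[2]) y) =
      algebraMap (v.adicCompletion ℚ) (AlgebraicClosure (v.adicCompletion ℚ)) (φ y))
    {n : ℕ} (e : CyclotomicField (cycLevel 2 (n + 2) ∅) ℚ →ₐ[ℚ] PadicAlgCl 2)
    (τ τ' : ZMod (2 ^ (n + 2)) → Field.absoluteGaloisGroup ℚ_[2])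
    (hτ : ∀ a : ZMod (2 ^ (n + 2)), IsUnit a →
      τ a • e (IsCyclotomicExtension.zeta (cycLevel 2 (n + 2) ∅) ℚ (CyclotomicField (cycLevel 2 (n + 2) ∅) ℚ)) =
        e (IsCyclotomicExtension.zeta (cycLevel 2 (n + 2) ∅) ℚ (CyclotomicField (cycLevel 2 (n + 2) ∅) ℚ)) ^ a.val)
    (hτ' : ∀ a : ZMod (2 ^ (n + 2)), IsUnit a →
      τ' a • e (IsCyclotomicExtension.zeta (cycLevel 2 (n + 2) ∅) ℚ (CyclotomicField (cycLevel 2 (n + 2) ∅) ℚ)) =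
        e (IsCyclotomicExtension.zeta (cycLevel 2 (n + 2) ∅) ℚ (CyclotomicField (cycLevel 2 (n + 2) ∅) ℚ)) ^ a.val)
    (Q₀ : localPoints W ℚ_[2])
    (hQv : WeierstrassCurve.Affine.Point.map (W' := W)
        (Φ : AlgebraicClosure ℚ_[2] →ₐ[ℚ] AlgebraicClosure (v.adicCompletion ℚ))
        (show (W.baseChange (AlgebraicClosure ℚ_[2])).toAffine.Point from Q₀) ∈
      localLayerPointsOfEmb κ (closureEmb (K := ℚ) (v.adicCompletion ℚ)) W n)
    (xv : CyclotomicField (cycLevel 2 (n + 2) ∅) ℚ) (a : ℕ → ℚ_[2]) :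
    ∑ b : (ZMod (2 ^ (n + 2)))ˣ, τ (b : ZMod (2 ^ (n + 2))) •
        ((∑' i : ℕ, algebraMap ℚ_[2] (PadicAlgCl 2) (a i) *
            (WeierstrassCurve.Affine.Point.zCoord (show (W.baseChange (AlgebraicClosure ℚ_[2])).toAffine.Point from Q₀)) ^ i) *
          e xv) =
      ∑ b : (ZMod (2 ^ (n + 2)))ˣ, τ' (b : ZMod (2 ^ (n + 2))) •
        ((∑' i : ℕ, algebraMap ℚ_[2] (PadicAlgCl 2) (a i) *
            (WeierstrassCurve.Affine.Point.zCoord (show (W.baseChange (AlgebraicClosure ℚ_[2])).toAffine.Point from Q₀)) ^ i) *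
          e xv) := by
  refine Finset.sum_congr rfl fun b _ => ?_
  have hfix : ((τ (b : ZMod (2 ^ (n + 2))))⁻¹ * τ' (b : ZMod (2 ^ (n + 2)))) •
      e (IsCyclotomicExtension.zeta (cycLevel 2 (n + 2) ∅) ℚ (CyclotomicField (cycLevel 2 (n + 2) ∅) ℚ)) =
      e (IsCyclotomicExtension.zeta (cycLevel 2 (n + 2) ∅) ℚ (CyclotomicField (cycLevel 2 (n + 2) ∅) ℚ)) := by
    rw [mul_smul, hτ' _ b.isUnit, ← hτ _ b.isUnit, inv_smul_smul]
  conv_rhs => rw [show τ' (b : ZMod (2 ^ (n + 2))) =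
    τ (b : ZMod (2 ^ (n + 2))) * ((τ (b : ZMod (2 ^ (n + 2))))⁻¹ * τ' (b : ZMod (2 ^ (n + 2)))) from (mul_inv_cancel_left _ _).symm,
    mul_smul, gal_smul_kz_summand_eq hκ Φ φ hΦφ e _ hfix Q₀ hQv xv a]

end Layer

/-! ## §3 One lift family ⟹ every lift family, for the (KZ) clause of the fact -/

section Lifts

variable (v : HeightOneSpectrum (𝓞 ℚ)) (W : WeierstrassCurve ℚ) [W.IsElliptic] (κ : ZpExtension ℚ 2) (hκ : κ.IsCyclotomic)
  [ContinuousSMul ℤ_[2] (W.tateModule 2)]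

include hκ in
set_option backward.isDefEq.respectTransparency false in
/-- **FRAME-C (one lift family ⟹ all).** For a continuous frame `(Φ, φ)`, a cyclotomic `κ`, an embedding `e` of the level `2^{n+2}`,
a class `y ∈ H¹(ℚ_n, T₂W)`, a value `x` and a point `Q₀` whose `Φ`-image lies in `E(ℚ_{n,v})`: if the (KZ) clause (residues of `t` AND the
value identity) holds for ONE lift family `τ₀` of `e(ζ) ↦ e(ζ)^b`, it holds — with the SAME `t` — for EVERY lift family `τ`
(`kz_rhs_lift_independent`). [folklore] -/
theorem expStarTatePairing_kz_allLifts_of_oneLift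
    (Φ : AlgebraicClosure ℚ_[2] ≃ₐ[ℚ] AlgebraicClosure (v.adicCompletion ℚ)) (φ : ℚ_[2] ≃+* v.adicCompletion ℚ)
    (hΦφ : ∀ y : ℚ_[2], Φ (algebraMap ℚ_[2] (AlgebraicClosure ℚ_[2]) y) =
      algebraMap (v.adicCompletion ℚ) (AlgebraicClosure (v.adicCompletion ℚ)) (φ y))
    {n : ℕ} (e : CyclotomicField (cycLevel 2 (n + 2) ∅) ℚ →ₐ[ℚ] PadicAlgCl 2)
    (τ₀ τ : ZMod (2 ^ (n + 2)) → Field.absoluteGaloisGroup ℚ_[2])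
    (hτ₀ : ∀ a : ZMod (2 ^ (n + 2)), IsUnit a →
      τ₀ a • e (IsCyclotomicExtension.zeta (cycLevel 2 (n + 2) ∅) ℚ (CyclotomicField (cycLevel 2 (n + 2) ∅) ℚ)) =
        e (IsCyclotomicExtension.zeta (cycLevel 2 (n + 2) ∅) ℚ (CyclotomicField (cycLevel 2 (n + 2) ∅) ℚ)) ^ a.val)
    (hτ : ∀ a : ZMod (2 ^ (n + 2)), IsUnit a →
      τ a • e (IsCyclotomicExtension.zeta (cycLevel 2 (n + 2) ∅) ℚ (CyclotomicField (cycLevel 2 (n + 2) ∅) ℚ)) =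
        e (IsCyclotomicExtension.zeta (cycLevel 2 (n + 2) ∅) ℚ (CyclotomicField (cycLevel 2 (n + 2) ∅) ℚ)) ^ a.val)
    (y : H1 (tateRep W 2) (κ.layerSubgroup n)) (xv : CyclotomicField (cycLevel 2 (n + 2) ∅) ℚ) (Q₀ : localPoints W ℚ_[2])
    (hQv : WeierstrassCurve.Affine.Point.map (W' := W)
        (Φ : AlgebraicClosure ℚ_[2] →ₐ[ℚ] AlgebraicClosure (v.adicCompletion ℚ))
        (show (W.baseChange (AlgebraicClosure ℚ_[2])).toAffine.Point from Q₀) ∈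
      localLayerPointsOfEmb κ (closureEmb (K := ℚ) (v.adicCompletion ℚ)) W n)
    (h₀ : ∃ t : ℤ_[2],
      (∀ k : ℕ, CyclotomicLayer.tatePairingPk W κ v n k y ⟨_, hQv⟩ = PadicInt.toZModPow k t) ∧
      algebraMap ℚ_[2] (PadicAlgCl 2) (t : ℚ_[2]) =
        ∑ b : (ZMod (2 ^ (n + 2)))ˣ, τ₀ (b : ZMod (2 ^ (n + 2))) •
          ((∑' i : ℕ, algebraMap ℚ_[2] (PadicAlgCl 2) (PowerSeries.coeff i (W.map (algebraMap ℚ ℚ_[2])).formalLog) *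
              (WeierstrassCurve.Affine.Point.zCoord (show (W.baseChange (AlgebraicClosure ℚ_[2])).toAffine.Point from Q₀)) ^ i) *
            e xv)) :
    ∃ t : ℤ_[2],
      (∀ k : ℕ, CyclotomicLayer.tatePairingPk W κ v n k y ⟨_, hQv⟩ = PadicInt.toZModPow k t) ∧
      algebraMap ℚ_[2] (PadicAlgCl 2) (t : ℚ_[2]) =
        ∑ b : (ZMod (2 ^ (n + 2)))ˣ, τ (b : ZMod (2 ^ (n + 2))) •
          ((∑' i : ℕ, algebraMap ℚ_[2] (PadicAlgCl 2) (PowerSeries.coeff i (W.map (algebraMap ℚ ℚ_[2])).formalLog) *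
              (WeierstrassCurve.Affine.Point.zCoord (show (W.baseChange (AlgebraicClosure ℚ_[2])).toAffine.Point from Q₀)) ^ i) *
            e xv) := by
  obtain ⟨t, ht, htval⟩ := h₀
  refine ⟨t, ht, ?_⟩
  rw [htval]
  exact kz_rhs_lift_independent hκ Φ φ hΦφ e τ₀ τ hτ₀ hτ Q₀ hQv xv _

end Lifts

end Summit.BirchSwinnertonDyer.BirchSwinnertonDyer.Theorems.SignedKatoOffTwo.FrameChange

end
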